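import Literature.Computability.QuantumComplexity.HTCnotUniversality
import Literature.Computability.QuantumComplexity.OneQubitEuler
import Literature.Computability.QuantumComplexity.CondGate
import Literature.Computability.Cryptography.QubitRegisterPauliXProofs
import HarnessLib

/-!
# Barenco et al. 1995: singly-controlled one-qubit gates from one-qubit gates and `CNOT`

Topic `Literature/Computability/QuantumComplexity`, grouping namespace `Barenco` (the paper).
Part of the discharge of `barenco1995_exactUniversality` (`HTCnotUniversality.lean`): the
subgroup `G_N = Subgroup.closure (oneQubitCnotGenerators N)` of `U(2^N)` generated by the
placements of one-qubit unitaries and of `CNOT` contains every **controlled one-qubit gate with a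
single control wire** (Barenco–Bennett–Cleve–DiVincenzo–Margolus–Shor–Sleator–Smolin–Weinfurter
1995, §5, Lemmas 5.1–5.3 with Lemma 4.3; Nielsen–Chuang 2010, §4.3, Fig. 4.6 and Cor. 4.2).

* `MemGen N M` — the matrix `M` is unitary and lies in `G_N`; closure under products and adjoints,
  and the generators: a one-qubit unitary on a wire (`memGen_onWire`) and `CNOT` on two wires
  (`memGen_cx`), both rewritten as label-controlled gates `ctrlGate` of `SandwichApprox.lean`
  (`placeGate_wireEmb_eq_ctrlGate`, `placeGate_pairEmb_cnot_eq_cx`);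
* `ctrl1 c b t V = ctrlGate t (z ↦ if z c = b then V else 1)` — `V` on wire `t` controlled by
  wire `c` carrying the bit `b`;
* **`memGen_ctrl1`**: `ctrl1 c b t V ∈ G_N` for every unitary `V`, `c ≠ t`, `b`. Proof as printed:
  Euler-decompose `V = e^{iα} R_z · R_x · R_z` (`OneQubit.exists_euler`); a controlled
  `z`-rotation is `R_z(θ/2)_t · CNOT · R_z(-θ/2)_t · CNOT` (Lemma 5.1 with `A = R_z(θ/2)`,
  `B = R_z(-θ/2)`, `C = 1`; `memGen_ctrl1_rz`), a controlled `x`-rotation is its conjugate by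
  `H_t` (`memGen_ctrl1_hrzh`), the controlled phase `∧₁(e^{iα})` is the one-qubit gate
  `diag(1, e^{iα})` on the control wire (Lemma 5.2; `ctrl1_smul_one_eq`), and the control value
  `0` is `∧₁(V⁻¹) · V_t` (`memGen_ctrl1` from `memGen_ctrl1_true`).

## References

* A. Barenco, C. H. Bennett, R. Cleve, D. P. DiVincenzo, N. Margolus, P. Shor, T. Sleator,
  J. A. Smolin, H. Weinfurter, *Elementary gates for quantum computation*, Phys. Rev. A 52 (1995)
  3457–3467, arXiv:quant-ph/9503016, §4 Lemma 4.3, §5 Lemmas 5.1–5.3 [BarencoEtAl1995].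
* M. A. Nielsen, I. L. Chuang, *Quantum Computation and Quantum Information*, CUP 2010, §4.3,
  Fig. 4.5–4.6, Cor. 4.2 [NielsenChuang2010].

## Design notes

* Everything is stated for matrices with the side predicate `MemGen` rather than for elements
  of the subtype `unitaryGroup`, so that the identities are plain matrix identities; the blocks of
  all label-controlled gates here are independent of the target bit, as `ctrlGate_mul` and
  `ctrlGate_mem_unitaryGroup` require.
-/

noncomputable section

namespace Literature.Computability.QuantumComplexity.Barenco

open Cryptography Matrix OneQubit

variable {N : ℕ}

/-! ### Membership in the Barenco subgroup -/

/-- `MemGen N M`: the `N`-qubit matrix `M` is unitary and lies in the subgroup of `U(2^N)`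
generated by the placements of one-qubit unitaries and of `CNOT`
(`oneQubitCnotGenerators N`). [cite: BarencoEtAl1995, abstract and §2] -/
def MemGen (N : ℕ) (M : Matrix (QReg N) (QReg N) ℂ) : Prop :=
  ∃ h : M ∈ Matrix.unitaryGroup (QReg N) ℂ,
    (⟨M, h⟩ : Matrix.unitaryGroup (QReg N) ℂ) ∈ Subgroup.closure (oneQubitCnotGenerators N)

/-- A `MemGen` matrix is unitary. [folklore] -/
theorem MemGen.mem_unitaryGroup {M : Matrix (QReg N) (QReg N) ℂ} (h : MemGen N M) :
    M ∈ Matrix.unitaryGroup (QReg N) ℂ := h.1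

/-- The identity is in the subgroup. [folklore] -/
theorem memGen_one : MemGen N (1 : Matrix (QReg N) (QReg N) ℂ) :=
  ⟨Submonoid.one_mem _, by
    have : (⟨1, Submonoid.one_mem _⟩ : Matrix.unitaryGroup (QReg N) ℂ) = 1 := rfl
    rw [this]; exact one_mem _⟩

/-- `MemGen` is closed under products. [folklore] -/
theorem MemGen.mul {M M' : Matrix (QReg N) (QReg N) ℂ} (h : MemGen N M) (h' : MemGen N M') :
    MemGen N (M * M') := by
  obtain ⟨hM, hm⟩ := h
  obtain ⟨hM', hm'⟩ := h'
  refine ⟨Submonoid.mul_mem _ hM hM', ?_⟩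
  have : (⟨M * M', Submonoid.mul_mem _ hM hM'⟩ : Matrix.unitaryGroup (QReg N) ℂ) =
      ⟨M, hM⟩ * ⟨M', hM'⟩ := rfl
  rw [this]
  exact mul_mem hm hm'

/-- `MemGen` is closed under adjoints (inverses). [folklore] -/
theorem MemGen.conjTranspose {M : Matrix (QReg N) (QReg N) ℂ} (h : MemGen N M) : MemGen N Mᴴ := by
  obtain ⟨hM, hm⟩ := h
  refine ⟨Unitary.star_mem hM, ?_⟩
  have : (⟨Mᴴ, Unitary.star_mem hM⟩ : Matrix.unitaryGroup (QReg N) ℂ) = (⟨M, hM⟩)⁻¹ := rfl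
  rw [this]
  exact inv_mem hm

/-- Triple products. [folklore] -/
theorem MemGen.mul₃ {A B C : Matrix (QReg N) (QReg N) ℂ} (hA : MemGen N A) (hB : MemGen N B)
    (hC : MemGen N C) : MemGen N (A * B * C) :=
  (hA.mul hB).mul hC

/-- An element of `U(2^N)` whose matrix is `MemGen` lies in the Barenco subgroup. [folklore] -/
theorem MemGen.mem_closure {U : Matrix.unitaryGroup (QReg N) ℂ}
    (h : MemGen N (U : Matrix (QReg N) (QReg N) ℂ)) :
    U ∈ Subgroup.closure (oneQubitCnotGenerators N) := by
  obtain ⟨hU, hm⟩ := h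
  exact hm

/-- The placement of a one-qubit unitary is a generator. [cite: BarencoEtAl1995, §2] -/
theorem memGen_placeGate_one (e : Fin 1 ↪ Fin N) {V : Matrix (QReg 1) (QReg 1) ℂ}
    (hV : V ∈ Matrix.unitaryGroup (QReg 1) ℂ) : MemGen N (placeGate e V) :=
  ⟨placeGate_mem_unitaryGroup_holds e hV,
    Subgroup.subset_closure (Or.inl ⟨e, ⟨V, hV⟩, rfl⟩)⟩

/-- The placement of `CNOT` is a generator. [cite: BarencoEtAl1995, §2] -/
theorem memGen_placeGate_cnot (e : Fin 2 ↪ Fin N) : MemGen N (placeGate e cnot) :=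
  ⟨placeGate_mem_unitaryGroup_holds e cnot_mem_unitaryGroup_holds,
    Subgroup.subset_closure (Or.inr ⟨e, rfl⟩)⟩

/-! ### One-qubit gates and `CNOT` as label-controlled gates -/

/-- The Pauli `X` gate by entries. [cite: NielsenChuang2010, §1.3.1] -/
theorem pauliX_eq_m2 : pauliX = m2 0 1 1 0 := by
  ext x y
  obtain rfl | rfl := eq_q0_or_eq_q1 x <;> obtain rfl | rfl := eq_q0_or_eq_q1 y <;>
    simp [pauliX_apply]

/-- **A one-qubit gate on wire `t` is the label-controlled gate with constant block.**
[cite: NielsenChuang2010, §4.3] -/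
theorem placeGate_wireEmb_eq_ctrlGate (t : Fin N) (V : Matrix (QReg 1) (QReg 1) ℂ) :
    placeGate (wireEmb t) V = ctrlGate t (fun _ => V) := by
  ext x z
  rw [placeGate_apply, ctrlGate_apply]
  have hx : x ∘ wireEmb t = fun _ => x t := funext fun _ => by simp
  have hz : z ∘ wireEmb t = fun _ => z t := funext fun _ => by simp
  have hiff : (∀ i, i ∉ Set.range (wireEmb t) → x i = z i) ↔ EqOff [t] z x := by
    simp only [range_wireEmb, Set.mem_singleton_iff]
    exact ⟨fun h' i hi => (h' i (by simpa using hi)).symm,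
      fun h' i hi => (h' i (by simpa using hi)).symm⟩
  rw [hx, hz]
  by_cases h : EqOff [t] z x
  · rw [if_pos (hiff.2 h), if_pos h]
  · rw [if_neg (fun h' => h (hiff.1 h')), if_neg h]

/-- A one-qubit unitary on wire `t`, as a label-controlled gate, is in the subgroup.
[cite: BarencoEtAl1995, §2] -/
theorem memGen_onWire (t : Fin N) {V : Matrix (QReg 1) (QReg 1) ℂ}
    (hV : V ∈ Matrix.unitaryGroup (QReg 1) ℂ) : MemGen N (ctrlGate t (fun _ => V)) := by
  rw [← placeGate_wireEmb_eq_ctrlGate]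
  exact memGen_placeGate_one _ hV

/-- The `CNOT` with control `c` and target `t` as a label-controlled gate: block `X` on the labels
with `z c = 1`, block `1` otherwise. [cite: NielsenChuang2010, §4.3] -/
def cx (c t : Fin N) : Matrix (QReg N) (QReg N) ℂ :=
  ctrlGate t (fun z => if z c = true then pauliX else 1)

/-- **`CNOT` placed on the wires `(c, t)` is the label-controlled `X`.** [cite: NielsenChuang2010, §4.3] -/
theorem placeGate_pairEmb_cnot_eq_cx {c t : Fin N} (h : c ≠ t) :
    placeGate (pairEmb c t h) cnot = cx c t := by
  ext x z
  rw [cx, placeGate_apply, ctrlGate_apply]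
  have hoff : (∀ i, i ∉ Set.range (pairEmb c t h) → x i = z i) ↔
      ∀ i, i ≠ c → i ≠ t → x i = z i := by
    simp only [range_pairEmb, Set.mem_insert_iff, Set.mem_singleton_iff, not_or, and_imp]
  have hcn : cnot (x ∘ pairEmb c t h) (z ∘ pairEmb c t h) =
      if x c = z c ∧ x t = (z t ^^ z c) then 1 else 0 := by
    simp [cnot]
  rw [hcn]
  by_cases hE : EqOff [t] z x
  · have hzc : z c = x c := hE c (by simpa using h)
    have h1 : ∀ i, i ≠ c → i ≠ t → x i = z i := fun i _ hit => (hE i (by simpa using hit)).symm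
    rw [if_pos (hoff.2 h1), if_pos hE, hzc]
    cases hxc : x c <;> cases hxt : x t <;> cases hzt : z t <;>
      simp [pauliX_apply, funext_iff]
  · rw [if_neg hE]
    by_cases h1 : ∀ i, i ∉ Set.range (pairEmb c t h) → x i = z i
    · rw [if_pos h1, if_neg]
      rintro ⟨h2, -⟩
      apply hE
      intro i hi
      by_cases hic : i = c
      · subst hic; exact h2.symm
      · exact (hoff.1 h1 i hic (by simpa using hi)).symm
    · rw [if_neg h1]

/-- `cx c t ∈ G_N` for `c ≠ t`. [cite: BarencoEtAl1995, §2] -/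
theorem memGen_cx {c t : Fin N} (h : c ≠ t) : MemGen N (cx c t) := by
  rw [← placeGate_pairEmb_cnot_eq_cx h]
  exact memGen_placeGate_cnot _

/-! ### Singly-controlled gates -/

/-- **`ctrl1 c b t V`**: the one-qubit gate `V` on wire `t`, applied iff wire `c` carries the bit
`b` (`∧₁(V)` of Barenco et al. for `b = 1`, its `X`-conjugate for `b = 0`), as a label-controlled
gate. [cite: BarencoEtAl1995, §5] -/
def ctrl1 (c : Fin N) (b : Bool) (t : Fin N) (V : Matrix (QReg 1) (QReg 1) ℂ) :
    Matrix (QReg N) (QReg N) ℂ :=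
  ctrlGate t (fun z => if z c = b then V else 1)

/-- Blocks read off a wire `c ≠ t` do not depend on the target bit. [folklore] -/
theorem blocks_update {c t : Fin N} (h : c ≠ t) (f : Bool → Matrix (QReg 1) (QReg 1) ℂ)
    (z : QReg N) (b : Bool) : f (Function.update z t b c) = f (z c) := by
  rw [Function.update_of_ne h]

/-- `ctrl1` of the identity block is the identity. [folklore] -/
theorem ctrl1_one (c : Fin N) (b : Bool) (t : Fin N) : ctrl1 c b t 1 = (1 : Matrix (QReg N) (QReg N) ℂ) := by
  rw [ctrl1]
  have : (fun z : QReg N => if z c = b then (1 : Matrix (QReg 1) (QReg 1) ℂ) else 1) = fun _ => 1 := by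
    funext z; split_ifs <;> rfl
  rw [this, ← placeGate_wireEmb_eq_ctrlGate, placeGate_one]

/-- **`ctrl1` is multiplicative in the block.** [folklore] -/
theorem ctrl1_mul {c t : Fin N} (h : c ≠ t) (b : Bool) (V W : Matrix (QReg 1) (QReg 1) ℂ) :
    ctrl1 c b t V * ctrl1 c b t W = ctrl1 c b t (V * W) := by
  rw [ctrl1, ctrl1, ctrl1, ctrlGate_mul t _ (fun z b' => blocks_update h (fun a => if a = b then V else 1) z b')]
  congr 1
  funext z
  split_ifs <;> simp

/-- A one-qubit gate on the target wire times `ctrl1`: blockwise product. [folklore] -/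
theorem onWire_mul_ctrl1 {c t : Fin N} (b : Bool) (U V : Matrix (QReg 1) (QReg 1) ℂ) :
    ctrlGate t (fun _ => U) * ctrl1 c b t V = ctrlGate t (fun z => if z c = b then U * V else U) := by
  rw [ctrl1, ctrlGate_mul t _ (fun _ _ => rfl)]
  congr 1
  funext z
  split_ifs <;> simp

/-- `ctrl1` times a one-qubit gate on the target wire: blockwise product. [folklore] -/
theorem ctrl1_mul_onWire {c t : Fin N} (h : c ≠ t) (b : Bool) (U V : Matrix (QReg 1) (QReg 1) ℂ) :
    ctrl1 c b t V * ctrlGate t (fun _ => U) = ctrlGate t (fun z => if z c = b then V * U else U) := by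
  rw [ctrl1, ctrlGate_mul t _ (fun z b' => blocks_update h (fun a => if a = b then V else 1) z b')]
  congr 1
  funext z
  split_ifs <;> simp

/-- `ctrl1` is unitary for a unitary block. [folklore] -/
theorem ctrl1_mem_unitaryGroup {c t : Fin N} (h : c ≠ t) (b : Bool) {V : Matrix (QReg 1) (QReg 1) ℂ}
    (hV : V ∈ Matrix.unitaryGroup (QReg 1) ℂ) : ctrl1 c b t V ∈ Matrix.unitaryGroup (QReg N) ℂ := by
  refine ctrlGate_mem_unitaryGroup t (fun z => ?_)
    (fun z b' => blocks_update h (fun a => if a = b then V else 1) z b')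
  by_cases hz : z c = b
  · rw [if_pos hz]; exact hV
  · rw [if_neg hz]; exact Submonoid.one_mem _

/-- **Controlled `z`-rotation** (Barenco et al. 1995, Lemma 5.1 with Lemma 4.3 for a diagonal
`W`; Nielsen–Chuang 2010, Fig. 4.6): for `w² = u`,
`∧₁(rz u) = (rz w)_t · CNOT(c,t) · (rz w̄)_t · CNOT(c,t)`, since `X rz(w̄) X = rz w`. Hence
`∧₁(rz u) ∈ G_N`. [cite: BarencoEtAl1995, Lemma 5.1] -/
theorem memGen_ctrl1_rz {c t : Fin N} (h : c ≠ t) {u : ℂ} (hu : ‖u‖ = 1) :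
    MemGen N (ctrl1 c true t (rz u)) := by
  obtain ⟨w, hw, hwu⟩ := exists_sq_eq_of_norm_eq_one hu
  have key : ctrl1 c true t (rz u) =
      ctrlGate t (fun _ => rz w) * cx c t * (ctrlGate t (fun _ => rz (starRingEnd ℂ w)) * cx c t) := by
    have h1 : ctrlGate t (fun _ => rz (starRingEnd ℂ w)) * cx c t =
        ctrlGate t (fun z => if z c = true then rz (starRingEnd ℂ w) * pauliX else rz (starRingEnd ℂ w)) :=
      onWire_mul_ctrl1 true _ _
    have h2 : cx c t * (ctrlGate t (fun _ => rz (starRingEnd ℂ w)) * cx c t) =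
        ctrlGate t (fun z => if z c = true then pauliX * (rz (starRingEnd ℂ w) * pauliX)
          else rz (starRingEnd ℂ w)) := by
      rw [h1, cx, ctrlGate_mul t _ (fun z b' => blocks_update h (fun a => if a = true then pauliX else 1) z b')]
      congr 1
      funext z
      split_ifs <;> simp
    rw [Matrix.mul_assoc, h2, ctrlGate_mul t _ (fun _ _ => rfl), ctrl1]
    congr 1
    funext z
    by_cases hz : z c = true
    · rw [if_pos hz, if_pos hz, pauliX_eq_m2, rz, rz, rz, m2_mul_m2, m2_mul_m2, m2_mul_m2,
        Complex.conj_conj, ← hwu, m2_inj]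
      refine ⟨by ring, by ring, by ring, ?_⟩
      rw [map_pow]; ring
    · rw [if_neg hz, if_neg hz, rz_mul_rz, mul_conj_eq_one hw, rz_one]
  rw [key]
  have hw' : ‖starRingEnd ℂ w‖ = 1 := by rwa [Complex.norm_conj]
  exact ((memGen_onWire t (rz_mem_unitaryGroup hw)).mul (memGen_cx h)).mul
    ((memGen_onWire t (rz_mem_unitaryGroup hw')).mul (memGen_cx h))

/-- **Controlled `x`-rotation**: `∧₁(H rz u H) = H_t · ∧₁(rz u) · H_t ∈ G_N`
(Nielsen–Chuang 2010, Fig. 4.6 / Cor. 4.2 with `HZH = X`). [cite: BarencoEtAl1995, Lemma 5.1] -/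
theorem memGen_ctrl1_hrzh {c t : Fin N} (h : c ≠ t) {u : ℂ} (hu : ‖u‖ = 1) :
    MemGen N (ctrl1 c true t (hGate * rz u * hGate)) := by
  have key : ctrl1 c true t (hGate * rz u * hGate) =
      ctrlGate t (fun _ => hGate) * (ctrl1 c true t (rz u) * ctrlGate t (fun _ => hGate)) := by
    rw [ctrl1_mul_onWire h, ctrlGate_mul t _ (fun _ _ => rfl), ctrl1]
    congr 1
    funext z
    split_ifs
    · rw [Matrix.mul_assoc]
    · rw [hGate_mul_hGate]
  rw [key]
  exact (memGen_onWire t hGate_mem_unitaryGroup_holds).mul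
    ((memGen_ctrl1_rz h hu).mul (memGen_onWire t hGate_mem_unitaryGroup_holds))

/-- **Controlled phase is a one-qubit gate on the control wire** (Barenco et al. 1995,
Lemma 5.2: `∧₁(e^{iα}) = E ⊗ 1` with `E = diag(1, e^{iα})`). [cite: BarencoEtAl1995, Lemma 5.2] -/
theorem ctrl1_smul_one_eq (c t : Fin N) (a : ℂ) :
    ctrl1 c true t (a • (1 : Matrix (QReg 1) (QReg 1) ℂ)) = ctrlGate c (fun _ => m2 1 0 0 a) := by
  ext x z
  rw [ctrl1, ctrlGate_apply, ctrlGate_apply]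
  by_cases hxz : x = z
  · subst hxz
    rw [if_pos (eqOff_refl _), if_pos (eqOff_refl _), m2_apply]
    cases hxc : x c
    · simp
    · simp
  · -- off-diagonal entries vanish on both sides
    have lhs0 : (if EqOff [t] z x then (if z c = true then a • (1 : Matrix (QReg 1) (QReg 1) ℂ) else 1)
        (fun _ => x t) (fun _ => z t) else 0) = 0 := by
      split_ifs with hE hzc
      · rw [Matrix.smul_apply, Matrix.one_apply, if_neg, smul_zero]
        intro hh; apply hxz
        rw [eqOff_singleton_iff.1 hE, show z t = x t from (congrFun hh 0).symm]; simp
      · rw [Matrix.one_apply, if_neg]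
        intro hh; apply hxz
        rw [eqOff_singleton_iff.1 hE, show z t = x t from (congrFun hh 0).symm]; simp
      · rfl
    have rhs0 : (if EqOff [c] z x then m2 1 0 0 a (fun _ => x c) (fun _ => z c) else 0) = 0 := by
      split_ifs with hE
      · rw [m2_apply]
        have hct : x c ≠ z c := by
          intro hh; apply hxz
          rw [eqOff_singleton_iff.1 hE, ← hh]; simp
        cases hxc : x c <;> cases hzc : z c <;> simp_all
      · rfl
    rw [lhs0, rhs0]

/-- The phase gate `diag(1, a)`, `‖a‖ = 1`, is unitary. [folklore] -/
theorem m2_phase_mem_unitaryGroup {a : ℂ} (ha : ‖a‖ = 1) :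
    m2 1 0 0 a ∈ Matrix.unitaryGroup (QReg 1) ℂ := by
  rw [Matrix.mem_unitaryGroup_iff, star_m2, m2_mul_m2, one_eq_m2, m2_inj]
  simp [mul_conj_eq_one ha]

/-- **Every singly-controlled unitary with control value `1` is in `G_N`** (Barenco et al. 1995,
Lemma 5.1 + Cor. 5.3: `∧₁(W) ∈ G` for `W ∈ SU(2)` via `W = A X B X C`, and Lemma 5.2 for the
phase). Here via the Euler form `V = e^{iα} rz u₁ (H rz u₂ H) rz u₃` and blockwise
multiplicativity of `ctrl1`. [cite: BarencoEtAl1995, §5 Lemmas 5.1-5.2 and Cor. 5.3] -/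
theorem memGen_ctrl1_true {c t : Fin N} (h : c ≠ t) {V : Matrix (QReg 1) (QReg 1) ℂ}
    (hV : V ∈ Matrix.unitaryGroup (QReg 1) ℂ) : MemGen N (ctrl1 c true t V) := by
  obtain ⟨a, u₁, u₂, u₃, ha, hu₁, hu₂, hu₃, hVeq⟩ := exists_euler hV
  have hprod : a • (1 : Matrix (QReg 1) (QReg 1) ℂ) * rz u₁ * (hGate * rz u₂ * hGate) * rz u₃ = V := by
    rw [hVeq, Matrix.mul_assoc, Matrix.mul_assoc, smul_one_mul, ← Matrix.mul_assoc]
  have hsplit : ctrl1 c true t V = ctrl1 c true t (a • 1) * ctrl1 c true t (rz u₁) *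
      ctrl1 c true t (hGate * rz u₂ * hGate) * ctrl1 c true t (rz u₃) := by
    rw [ctrl1_mul h, ctrl1_mul h, ctrl1_mul h, hprod]
  rw [hsplit, ctrl1_smul_one_eq]
  exact (((memGen_onWire c (m2_phase_mem_unitaryGroup ha)).mul (memGen_ctrl1_rz h hu₁)).mul
    (memGen_ctrl1_hrzh h hu₂)).mul (memGen_ctrl1_rz h hu₃)

/-- **Every singly-controlled unitary is in `G_N`**, for either control value: for the value `0`,
`ctrl1 c false t V = ∧₁(V†) · V_t`. [cite: BarencoEtAl1995, §5] -/
theorem memGen_ctrl1 {c t : Fin N} (h : c ≠ t) (b : Bool) {V : Matrix (QReg 1) (QReg 1) ℂ}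
    (hV : V ∈ Matrix.unitaryGroup (QReg 1) ℂ) : MemGen N (ctrl1 c b t V) := by
  cases b
  · have hVV : Vᴴ * V = 1 := by
      simpa only [Matrix.star_eq_conjTranspose] using Matrix.mem_unitaryGroup_iff'.1 hV
    have key : ctrl1 c false t V = ctrl1 c true t Vᴴ * ctrlGate t (fun _ => V) := by
      rw [ctrl1_mul_onWire h, ctrl1]
      congr 1
      funext z
      cases hz : z c
      · simp
      · simp [hVV]
    rw [key]
    exact (memGen_ctrl1_true h (Unitary.star_mem hV)).mul (memGen_onWire t hV)
  · exact memGen_ctrl1_true h hV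

end Literature.Computability.QuantumComplexity.Barenco
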